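import Summits.HubbardSuperconductivity.HubbardSuperconductivity.Theses.AnisotropyChord
import Summits.HubbardSuperconductivity.HubbardSuperconductivity.Theorems.AnisotropyChordChordToOrderXY

/-!
# Crux `ChordFM` (stmt-HubbardSuperconductivity-8147) — line `split-chordxy-ferroside`
# = the TYPED DECOMPOSITION `ChordFM ⇐ ChordXY ∧ FerroSideChord` (crux-strategist, 2026-08-17)

Notation: `H_M(Δ) = xxzHamiltonian 1 (torusGraph 2 M) (-1) Δ`, `Λ(ψ) = Re⟨ψ, S⁺_tot S⁻_tot ψ⟩`,
`S = M²/2` (exact ferromagnetic value `Λ_M(1) = S(S+1)`, item `FerroPointValue`, PROVED).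

Two stubs = the two PIECES, both ROUTE ITEMS referred to BY NAME, one per physical regime of the
Ising coupling:
* `stub_chordXY : ChordXY` — the route's Tier-A transport crux (stmt-8146): on the
  antiferromagnetic side `Δ ∈ [-1,0]`, `(1+Δ)·Λ(ψ₀) ≤ Λ(ψ)` relative to the KLS-point value.
* `stub_ferroSideChord : FerroSideChord` — the NEW piece (stmt-19089, filed by this seat): on the
  ferromagnetic side `Δ ∈ [0,1]` (all couplings ferromagnetic), the chord from the exact FM value,
  `((1+Δ)/2)·S(S+1) ≤ Λ(ψ)`.
Composition `ChordFM_of` (kernel-checked, no sorry; = the glue item `ChordFMOfPieces`, stmt-19090,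
whose proof is attached as evidence `AnisotropyChordChordFMOfPieces.lean`): the seam is the KLS
point — for `Δ ≥ 0` the FM-side chord verbatim; for `Δ < 0` the FM-side chord AT `Δ = 0`, evaluated
at an EXISTING normalised sector ground state `ψ₀` of `H_M(0)` (Perron vector of the half-filled
hard-core gas, `exists_unit_sectorGroundState_xy`), is the reflection-positivity-free anchor
`S(S+1)/2 ≤ Λ(ψ₀)` (planar order `m²_xy ≥ 1/8` at every even `M ≥ 4`), which `ChordXY` transports
to `Δ`.

Probes (bc/, lean check, all `first | exact? | simpa | unfold;simpa | aesop`): each stub ↛ ChordFM,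
each stub ↛ HubbardSuperconductivity (4/4 fail); ChordFM ↛ S, S ↛ ChordFM; ChordFM → FerroSideChord
holds (restriction; recorded), ChordFM ↛ ChordXY.
Disproof used: none exists for this crux (no Disproof.lean). Dead lines: none registered before.
-/

namespace Summit.HubbardSuperconductivity.HubbardSuperconductivity.Cruxes.ChordFM.SplitChordxyFerroside

open Matrix Literature.MathematicalPhysics.QuantumLattice Literature.Probability.LatticeModels
open Summit.HubbardSuperconductivity.HubbardSuperconductivity.Theses.AnisotropyChord
open Summit.HubbardSuperconductivity.HubbardSuperconductivity.Theorems.AnisotropyChord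
  (exists_unit_sectorGroundState_xy)

/-- STUB 1 = piece `ChordXY` (the route's Tier-A crux stmt-HubbardSuperconductivity-8146, by name). -/
theorem stub_chordXY : ChordXY := by
  sorry

/-- STUB 2 = piece `FerroSideChord` (route item stmt-HubbardSuperconductivity-19089, by name: the
Tier-B chord restricted to the ferromagnetic side `Δ ∈ [0,1]`). -/
theorem stub_ferroSideChord : FerroSideChord := by
  sorry

/-- COMPOSITION `ChordXY → FerroSideChord → ChordFM` (= the glue item `ChordFMOfPieces`; the same
proof is attached as evidence `AnisotropyChordChordFMOfPieces.lean` for a prover to land under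
Theorems). [folklore] -/
theorem ChordFM_of (hXY : ChordXY) (hF : FerroSideChord) : ChordFM := by
  intro M _ hE h4 Δ hΔ ψ hmem hψ1 heig
  by_cases hΔ0 : 0 ≤ Δ
  · -- ferromagnetic side `Δ ∈ [0,1]`: the FM-side chord verbatim
    exact hF M hE h4 Δ ⟨hΔ0, hΔ.2⟩ ψ hmem hψ1 heig
  · -- antiferromagnetic side `Δ ∈ [-1,0)`: RP-free anchor at the KLS point, transported by ChordXY
    obtain ⟨ψ₀, hmem₀, hψ₀1, heig₀⟩ :=
      exists_unit_sectorGroundState_xy M hE (le_trans (by norm_num) h4)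
    have hA := hF M hE h4 0 ⟨le_rfl, by norm_num⟩ ψ₀ hmem₀ hψ₀1 heig₀
    have hC := hXY M hE h4 Δ ⟨hΔ.1, (not_le.mp hΔ0).le⟩ ψ₀ ψ hmem₀ hψ₀1 heig₀ hmem hψ1 heig
    have h1 : 0 ≤ 1 + Δ := by linarith [hΔ.1]
    calc (1 + Δ) / 2 * ((M : ℝ) ^ 2 / 2 * ((M : ℝ) ^ 2 / 2 + 1))
        = (1 + Δ) * ((1 + 0) / 2 * ((M : ℝ) ^ 2 / 2 * ((M : ℝ) ^ 2 / 2 + 1))) := by ring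
      _ ≤ (1 + Δ) * (star ψ₀ ⬝ᵥ Matrix.mulVec ((∑ x : TorusSite 2 M, onSite x (spinRaise 1)) *
            (∑ y : TorusSite 2 M, onSite y (spinLower 1))) ψ₀).re :=
          mul_le_mul_of_nonneg_left hA h1
      _ ≤ _ := hC

/-- The glue item's statement itself, proved here too (= `ChordFM_of` curried). -/
theorem chordFMOfPieces : ChordFMOfPieces := fun hXY hF => ChordFM_of hXY hF

/-- The line closes the crux from its registered stubs (sorries live only in `stub_*`). -/
theorem ChordFM_closed : ChordFM := ChordFM_of stub_chordXY stub_ferroSideChord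

end Summit.HubbardSuperconductivity.HubbardSuperconductivity.Cruxes.ChordFM.SplitChordxyFerroside
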